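import Summits.ValiantsHypothesis.ValiantsHypothesis.Theorems.KPlusLogSqLawLiftingGeneralExcessNoGo
import Summits.ValiantsHypothesis.ValiantsHypothesis.Theorems.LacunarySymmetroidMatrixDescartesStubDescartesCeiling
import Summits.ValiantsHypothesis.ValiantsHypothesis.Theorems.KPlusLogSqLawTropicalCensusFourFourTight
import Summits.ValiantsHypothesis.ValiantsHypothesis.Theorems.KPlusLogSqLawTropicalCensusFiveFourTight
import Summits.ValiantsHypothesis.ValiantsHypothesis.Theorems.KPlusLogSqLawTropicalCensusSixFourSeventyThree
import Summits.ValiantsHypothesis.ValiantsHypothesis.Theorems.KPlusLogSqLawTropicalCensusSevenFourNinetyNine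
import Summits.ValiantsHypothesis.ValiantsHypothesis.Theorems.KPlusLogSqLawTropicalCensusEightFourOneTwentyNine
import Summits.ValiantsHypothesis.ValiantsHypothesis.Theorems.KPlusLogSqLawTropicalCensusNineFourOneSixtyThree
import Summits.ValiantsHypothesis.ValiantsHypothesis.Theorems.KPlusLogSqLawTropicalCensusTenFourTwoHundredOne
import Summits.ValiantsHypothesis.ValiantsHypothesis.Theorems.KPlusLogSqLawTropicalCensusElevenFourTwoFortyThree
import Summits.ValiantsHypothesis.ValiantsHypothesis.Theorems.KPlusLogSqLawTropicalCensusThreeFive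

/-!
# Route «KPlusLogSqLaw» — PATCHWORK TRANSFER to the GENERAL real census: `ζ_gen(m,K) ≥ T(m,K)` at EVERY format, and the
# general `K = 4` column through `m = 11` (`ζ_gen(4,4) = 34`, `ζ_gen(5,4) = 55` Descartes-sharp; `ζ_gen(m,4) ≥ 2m² + 1`, `m ≤ 11`)

HONEST FRAMING.  Helper toward the lifting cruxes of route `KPlusLogSqLaw` (the live crux
`Summit.ValiantsHypothesis.ValiantsHypothesis.Theses.KPlusLogSqLaw.WeakLifting`, item `stmt-ValiantsHypothesis-19561`, and the aside
`…KPlusLogSqLaw.Lifting`, item `stmt-ValiantsHypothesis-19772`); cell `pub-symmetroid`, seat val-sym-lift-p1 g21, 2026-08-29; companion of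
`…KPlusLogSqLawLiftingGeneralExcessNoGo` (val-sym-lift-p?; the CONTROL COLUMN `ζ_gen` = positive-root census of GENERAL, not necessarily
symmetric, real pencils, `GeneralExcess.GenPosRootLawAt`).  BOOKKEEPING by composition of landed theorems — no new design, no `decide` blob:
the tree's Viro patchworking for general designs (`MatrixDescartes.Negative.le_card_posRoots_patch`: a dominant sign-alternating chain of `n + 1`
terms of a design of format `(m,K)` gives a general real `m × m` pencil of the SAME format with `≥ n` distinct positive determinant zeros) is
exactly the statement that the general real census DOMINATES the tropical census format by format —

* `tropRootLawAt_of_genPosRootLawAt : GenPosRootLawAt m K B → TropRootLawAt m K B` (**`T(m,K) ≤ ζ_gen(m,K)`**), with the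
  contrapositive `not_genPosRootLawAt_of_not_tropRootLawAt` (every tropical census FLOOR of the tree is a general real floor at the same
  format, no doubling — compare typer g11's `…GeneralDesignDoubling`, which pays size `2m` to land in SYMMETRIC pencils), and
  `genPosRootLawAt_descartes : GenPosRootLawAt m K (C(m+K−1, m) − 1)` (the Descartes ceiling `stub_descartesCeiling`, no symmetry used);

and therefore the tropical `K = 4` column of record (tight through `m = 5`: `…TropicalCensusFourFourTight`, `…FiveFourTight`; the GRADED
ROTATION-WALK rows `2m² + 1` of val-sym-trop-p3 g13 for `6 ≤ m ≤ 11`; the `(3,5)` row `≥ 27`) IS a column of the general real census: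

* `genPosRootLawAt_four_four_iff : GenPosRootLawAt 4 4 B ↔ 34 ≤ B` and `genPosRootLawAt_five_four_iff : GenPosRootLawAt 5 4 B ↔ 55 ≤ B`
  — **general real `4 × 4` and `5 × 5` four-letter pencils are DESCARTES-SHARP** (`ζ_gen = C(m+3,3) − 1`), extending the tree's
  `ζ_gen(3,4) = 19` (`GeneralExcess.not_genPosRootLawAt_three_four`, there from the explicit pencil `Census.G3K4E1`); hence the GENERAL EXCESS
  is exactly zero there too: `genExcessLawAt_four_four`, `genExcessLawAt_five_four` (every `E`);
* `not_genPosRootLawAt_six_four_72`, `…seven_four_98`, `…eight_four_128`, `…nine_four_162`, `…ten_four_200`, `…eleven_four_242`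
  (`ζ_gen(m,4) ≥ 2m² + 1`, `6 ≤ m ≤ 11`) and `not_genPosRootLawAt_three_five_26` (`ζ_gen(3,5) ≥ 27`).

These are statements about GENERAL pencils; they say nothing about the symmetric registers (Table S: `ζ_sym(4,4) ≥ 30`, `ζ_sym(5,4) ≥ 40`,
`ζ_sym(6,4) ≥ 53`, `ζ_sym(7,4) ≥ 70` of record are different objects), nothing about `TropicalB` / `WeakLifting` / `Lifting` in their
window, DoorA26 / DoorA34, `MatrixDescartes` (`stmt-ValiantsHypothesis-18050`) or `VP ≠ VNP`.  [folklore: Viro patchworking; composition of tree theorems]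
-/

-- `Summit.ValiantsHypothesis.ValiantsHypothesis.…` repeats a component by the D-0017 layout
-- (single-conjunct summit), which the `dupNamespace` linter flags; the name is mandated.
set_option linter.dupNamespace false
set_option autoImplicit false

namespace Summit.ValiantsHypothesis.ValiantsHypothesis.Theorems.KPlusLogSqLaw.GeneralExcess

open Summit.ValiantsHypothesis.ValiantsHypothesis.Theorems.MatrixDescartes.Negative
open Summit.ValiantsHypothesis.ValiantsHypothesis.Theorems.LacunarySymmetroidMatrixDescartes
open Summit.ValiantsHypothesis.ValiantsHypothesis.Theorems.LacunarySymmetroidMatrixDescartes.TropicalCensus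
open Summit.ValiantsHypothesis.ValiantsHypothesis.Theorems.KPlusLogSqLaw
open scoped BigOperators
open Polynomial

/-! ## 1. The patchwork transfer: `T(m,K) ≤ ζ_gen(m,K)` -/

/-- **Patchwork transfer (general pencils, same format).**  If every general real `K`-letter pencil of `m × m` matrices has at
most `B` distinct positive determinant zeros, then every sign-alternating dominant chain of every dominance design of format `(m,K)`
has at most `B` sign changes: `T(m,K) ≤ ζ_gen(m,K)`.  Proof: the tree's Viro patchworking `le_card_posRoots_patch` realises a chain
with `n` alternations by a general real pencil of the same format with `≥ n` positive zeros. [folklore: Viro patchworking] -/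
theorem tropRootLawAt_of_genPosRootLawAt {m K B : ℕ} (h : GenPosRootLawAt m K B) : TropRootLawAt m K B := by
  intro d v ε n θ p hε hθ hdom halt
  obtain ⟨T, hT⟩ := le_card_posRoots_patch d v ε hε θ hθ p hdom halt
  exact hT.trans (h d T)

/-- contrapositive: a tropical census floor is a general real census floor at the same format. [folklore] -/
theorem not_genPosRootLawAt_of_not_tropRootLawAt {m K B : ℕ} (h : ¬ TropRootLawAt m K B) : ¬ GenPosRootLawAt m K B :=
  fun hG => h (tropRootLawAt_of_genPosRootLawAt hG)

/-- **Descartes ceiling for general pencils**: `ζ_gen(m,K) ≤ C(m+K−1, m) − 1` (`stub_descartesCeiling`; no symmetry is used there).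
[folklore: Descartes' rule of signs on the count-vector support] -/
theorem genPosRootLawAt_descartes (m K : ℕ) (hK : 0 < K) : GenPosRootLawAt m K (Nat.choose (m + K - 1) m - 1) := by
  intro d S
  have h := stub_descartesCeiling K m hK d S
  omega

/-- the general excess is never negative: if the tropical row is EXACTLY `t` (`TropRootLawAt m K n ↔ t ≤ n`), then
`GenPosRootLawAt m K B → t ≤ B`. [bookkeeping] -/
theorem le_of_genPosRootLawAt_of_exact {m K t B : ℕ} (hex : ∀ n : ℕ, TropRootLawAt m K n ↔ t ≤ n)
    (h : GenPosRootLawAt m K B) : t ≤ B :=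
  (hex B).1 (tropRootLawAt_of_genPosRootLawAt h)

/-! ## 2. The general `K = 4` column: `m = 4, 5` Descartes-sharp -/

/-- `ζ_gen(4,4) ≥ 34`: the general law at `33` fails (tropical `T(4,4) = 34`, `census_four_four_exact`, transferred). [composition] -/
theorem not_genPosRootLawAt_four_four_33 : ¬ GenPosRootLawAt 4 4 33 :=
  not_genPosRootLawAt_of_not_tropRootLawAt census_four_four_exact.2

/-- `ζ_gen(4,4) ≤ 34` (Descartes, `C(7,4) − 1`). [composition] -/
theorem genPosRootLawAt_four_four_34 : GenPosRootLawAt 4 4 34 := by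
  have h := genPosRootLawAt_descartes 4 4 (by norm_num)
  have hc : Nat.choose (4 + 4 - 1) 4 = 35 := by decide
  rw [hc] at h
  exact h

/-- **`ζ_gen(4,4) = 34 = C(7,4) − 1`: general real `4 × 4` four-letter pencils are Descartes-sharp.** [composition] -/
theorem genPosRootLawAt_four_four_iff {B : ℕ} : GenPosRootLawAt 4 4 B ↔ 34 ≤ B := by
  constructor
  · intro h
    by_contra hB
    exact not_genPosRootLawAt_four_four_33 (genPosRootLawAt_mono (by omega) h)
  · intro hB
    exact genPosRootLawAt_mono hB genPosRootLawAt_four_four_34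

/-- `ζ_gen(5,4) ≥ 55`: the general law at `54` fails (tropical `T(5,4) = 55`, `census_five_four_exact`, transferred). [composition] -/
theorem not_genPosRootLawAt_five_four_54 : ¬ GenPosRootLawAt 5 4 54 :=
  not_genPosRootLawAt_of_not_tropRootLawAt census_five_four_exact.2

/-- `ζ_gen(5,4) ≤ 55` (Descartes, `C(8,5) − 1`). [composition] -/
theorem genPosRootLawAt_five_four_55 : GenPosRootLawAt 5 4 55 := by
  have h := genPosRootLawAt_descartes 5 4 (by norm_num)
  have hc : Nat.choose (5 + 4 - 1) 5 = 56 := by decide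
  rw [hc] at h
  exact h

/-- **`ζ_gen(5,4) = 55 = C(8,5) − 1`: general real `5 × 5` four-letter pencils are Descartes-sharp.** [composition] -/
theorem genPosRootLawAt_five_four_iff {B : ℕ} : GenPosRootLawAt 5 4 B ↔ 55 ≤ B := by
  constructor
  · intro h
    by_contra hB
    exact not_genPosRootLawAt_five_four_54 (genPosRootLawAt_mono (by omega) h)
  · intro hB
    exact genPosRootLawAt_mono hB genPosRootLawAt_five_four_55

/-- **General excess at `(4,4)` is EXACTLY ZERO**: `GenExcessLawAt 4 4 E` for every `E` (already `E = 0`). [composition] -/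
theorem genExcessLawAt_four_four (E : ℕ) : GenExcessLawAt 4 4 E := by
  intro n hn
  have h34 : 34 ≤ n := tropRootLawAt_four_four_iff.1 hn
  exact genPosRootLawAt_mono (by omega) genPosRootLawAt_four_four_34

/-- **General excess at `(5,4)` is EXACTLY ZERO**: `GenExcessLawAt 5 4 E` for every `E`. [composition] -/
theorem genExcessLawAt_five_four (E : ℕ) : GenExcessLawAt 5 4 E := by
  intro n hn
  have h55 : 55 ≤ n := by
    by_contra h
    exact census_five_four_exact.2 (tropRootLawAt_mono (by omega) hn)
  exact genPosRootLawAt_mono (by omega) genPosRootLawAt_five_four_55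

/-! ## 3. The general `K = 4` column, `6 ≤ m ≤ 11`: `ζ_gen(m,4) ≥ 2m² + 1` (GRADED ROTATION-WALK rows, transferred) -/

/-- `ζ_gen(6,4) ≥ 73` (`census_six_four_range_73`, transferred); Descartes ceiling `83`. [composition] -/
theorem not_genPosRootLawAt_six_four_72 : ¬ GenPosRootLawAt 6 4 72 :=
  not_genPosRootLawAt_of_not_tropRootLawAt census_six_four_range_73.2

/-- `ζ_gen(7,4) ≥ 99` (`census_seven_four_range_99`, transferred); Descartes ceiling `119`. [composition] -/
theorem not_genPosRootLawAt_seven_four_98 : ¬ GenPosRootLawAt 7 4 98 :=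
  not_genPosRootLawAt_of_not_tropRootLawAt census_seven_four_range_99.2

/-- `ζ_gen(8,4) ≥ 129` (`census_eight_four_range_129`, transferred); Descartes ceiling `164`. [composition] -/
theorem not_genPosRootLawAt_eight_four_128 : ¬ GenPosRootLawAt 8 4 128 :=
  not_genPosRootLawAt_of_not_tropRootLawAt census_eight_four_range_129.2

/-- `ζ_gen(9,4) ≥ 163` (`census_nine_four_range_163`, transferred); Descartes ceiling `219`. [composition] -/
theorem not_genPosRootLawAt_nine_four_162 : ¬ GenPosRootLawAt 9 4 162 :=
  not_genPosRootLawAt_of_not_tropRootLawAt census_nine_four_range_163.2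

/-- `ζ_gen(10,4) ≥ 201` (`census_ten_four_range_201`, transferred); Descartes ceiling `285`. [composition] -/
theorem not_genPosRootLawAt_ten_four_200 : ¬ GenPosRootLawAt 10 4 200 :=
  not_genPosRootLawAt_of_not_tropRootLawAt census_ten_four_range_201.2

/-- `ζ_gen(11,4) ≥ 243` (`census_eleven_four_range_243`, transferred); Descartes ceiling `363`. [composition] -/
theorem not_genPosRootLawAt_eleven_four_242 : ¬ GenPosRootLawAt 11 4 242 :=
  not_genPosRootLawAt_of_not_tropRootLawAt census_eleven_four_range_243.2

/-- `ζ_gen(3,5) ≥ 27` (`census_three_five`, transferred); Descartes ceiling `34`. [composition] -/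
theorem not_genPosRootLawAt_three_five_26 : ¬ GenPosRootLawAt 3 5 26 :=
  not_genPosRootLawAt_of_not_tropRootLawAt census_three_five.2

/-- the general `K = 4` column `6 ≤ m ≤ 11` in one conjunction (floors `2m² + 1` and Descartes ceilings `C(m+3,3) − 1`). [composition] -/
theorem genPosRootLawAt_four_column :
    (¬ GenPosRootLawAt 6 4 72 ∧ GenPosRootLawAt 6 4 83) ∧ (¬ GenPosRootLawAt 7 4 98 ∧ GenPosRootLawAt 7 4 119) ∧
    (¬ GenPosRootLawAt 8 4 128 ∧ GenPosRootLawAt 8 4 164) ∧ (¬ GenPosRootLawAt 9 4 162 ∧ GenPosRootLawAt 9 4 219) ∧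
    (¬ GenPosRootLawAt 10 4 200 ∧ GenPosRootLawAt 10 4 285) ∧ (¬ GenPosRootLawAt 11 4 242 ∧ GenPosRootLawAt 11 4 363) := by
  refine ⟨⟨not_genPosRootLawAt_six_four_72, ?_⟩, ⟨not_genPosRootLawAt_seven_four_98, ?_⟩,
    ⟨not_genPosRootLawAt_eight_four_128, ?_⟩, ⟨not_genPosRootLawAt_nine_four_162, ?_⟩,
    ⟨not_genPosRootLawAt_ten_four_200, ?_⟩, ⟨not_genPosRootLawAt_eleven_four_242, ?_⟩⟩
  · have h := genPosRootLawAt_descartes 6 4 (by norm_num)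
    have hc : Nat.choose (6 + 4 - 1) 6 = 84 := by decide
    rw [hc] at h; exact h
  · have h := genPosRootLawAt_descartes 7 4 (by norm_num)
    have hc : Nat.choose (7 + 4 - 1) 7 = 120 := by decide
    rw [hc] at h; exact h
  · have h := genPosRootLawAt_descartes 8 4 (by norm_num)
    have hc : Nat.choose (8 + 4 - 1) 8 = 165 := by decide
    rw [hc] at h; exact h
  · have h := genPosRootLawAt_descartes 9 4 (by norm_num)
    have hc : Nat.choose (9 + 4 - 1) 9 = 220 := by decide
    rw [hc] at h; exact h
  · have h := genPosRootLawAt_descartes 10 4 (by norm_num)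
    have hc : Nat.choose (10 + 4 - 1) 10 = 286 := by decide
    rw [hc] at h; exact h
  · have h := genPosRootLawAt_descartes 11 4 (by norm_num)
    have hc : Nat.choose (11 + 4 - 1) 11 = 364 := by decide
    rw [hc] at h; exact h

end Summit.ValiantsHypothesis.ValiantsHypothesis.Theorems.KPlusLogSqLaw.GeneralExcess
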